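import Literature.NumberTheory.LFunctions.WeilExplicit
import Literature.NumberTheory.LFunctions.WeilArchimedeanMoments
import Literature.NumberTheory.LFunctions.WeilArchimedeanPositivityProofs
import Literature.NumberTheory.LFunctions.RiemannSiegelStirling
import Literature.Analysis.SpecialFunctions.DigammaVerticalSeries
import Mathlib.MeasureTheory.Integral.IntervalIntegral.FundThmCalculus
import Mathlib.Analysis.SpecialFunctions.Log.Deriv

/-!
# Stub `stub_archBathtub` (line `Sketch`, crux `WeilComb.CombShapePositivity`, stmt-RiemannHypothesis-11229)
# — variation: explicit monotone comparison of the archimedean term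

For a Weil test `g` with `L = ‖g‖₁` (`weilNorm1`), `N = ‖g‖₂²` (`weilNorm2Sq`), `0 < L` and `2L² ≤ πN`:

`N (log(N/(2L²)) − 1) − (21/(5π)) L² ≤ Re W_∞(g ⋆ g̃)`.

Everything below is a comparison of the archimedean weight `ρ(u) = Re ψ(1/4 + iu/2)`
(`reDigammaQuarter`) against explicit functions, using only that `ρ` is even and increasing in `|u|`
(`reDigammaQuarter_even`, `reDigammaQuarter_mono`) plus two certified inputs of the tree
(`re_digamma_one_quarter_ge`: `ψ(¼) ≥ −4.22745354`, and the second-order Stirling bound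
`abs_re_digamma_sub_log_norm_add_re_le` for `Re ψ` on vertical lines):

1. `Re W_∞(g ⋆ g̃) = (1/2π) ∫ G ρ − N log π`, `G(u) = |ĝ(1/2+iu)|²` (`re_weilArchTerm_autocorr`).
2. **Level comparison** (`level_comparison`): for EVERY level `T ≥ 0`,
   `2πN ρ(T) − L² ∫_{−T}^{T} (ρ(T) − ρ(u)) du ≤ ∫ G ρ`,
   because `0 ≤ G ≤ L²` (`norm_weilMellin_half_line_le`), `∫ G = 2πN` (Plancherel) and `ρ − ρ(T)` has the
   sign of `|u| − T`. At the level `T = πN/L²` the left side is `L² ∫_{−T}^{T} ρ` (the bathtub value).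
3. **Step comparison on `[0, 2]`** (`integral_reDigammaQuarter_zero_two_ge`): `∫_a^b ρ ≥ (b − a) ρ(a)` for
   `0 ≤ a ≤ b`, on the four half-unit cells, with `ρ(a) ≥ ψ(¼) + 16a²/(1 + 4a²)` (first term of the
   vertical series, `sum_digammaTerm_le`): `∫_0^2 ρ ≥ −4.055`.
4. **Log comparison on `[2, T]`** (`reDigammaQuarter_ge_log`, `integral_reDigammaQuarter_two_ge`):
   `ρ(u) ≥ log(u/2) − (1/2 + π/3)/u² − 4/(3u³)` for `u > 0`, and the right side is the derivative of
   `F(u) = u log(u/2) − u + (1/2 + π/3)/u + 2/(3u²)`, so `∫_2^T ρ ≥ F(T) − F(2) ≥ T log(T/2) − T + 2 − (5/12 + π/6)`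
   (FTC in inequality form, `intervalIntegral.sub_le_integral_of_hasDeriv_right_of_le`).
5. Hence `∫_{−T}^{T} ρ ≥ 2T(log(T/2) − 1) − 63/10 (≥ … − 42/5)` for `T ≥ 2`
   (`integral_reDigammaQuarter_symm_ge`), and the stub follows by `L² T = πN` (pure algebra).

This file is independent of the `arg Γ`–Stirling route of `WeilCombCombShapePositivityStubArchBathtub.lean`; it lives in
the sub-namespace `…WeilCombBohrFejer.ArchMonotone` so that `stub_archBathtub` keeps its registered name and signature.
-/

noncomputable section

-- the sub-problem path RiemannHypothesis/RiemannHypothesis duplicates a namespace (D-0017)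
set_option linter.dupNamespace false

open scoped BigOperators ComplexConjugate
open Complex MeasureTheory Set

namespace Summit.RiemannHypothesis.RiemannHypothesis.Theorems.WeilCombBohrFejer.ArchMonotone

open Literature.NumberTheory.LFunctions
open Literature.Analysis.SpecialFunctions (reDigammaQuarter reDigammaQuarter_even reDigammaQuarter_mono
  continuous_reDigammaQuarter reDigammaQuarter_zero sum_digammaTerm_le re_digamma_one_quarter_ge
  digammaTerm digammaNode)

/-! ### 1. The archimedean term of an autocorrelation -/

/-- `Re W_∞(g ⋆ g̃) = (1/2π) ∫ |ĝ(1/2+iu)|² ρ(u) du − ‖g‖₂² log π` (`weilArchIntegral_weilConv_weilReflect`,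
`weilConv_weilReflect_apply_zero`). [folklore] -/
theorem re_weilArchTerm_autocorr {g : ℝ → ℂ} (hg : IsWeilTest g) :
    (weilArchTerm (weilConv g (weilReflect g))).re =
      1 / (2 * Real.pi) * (∫ u : ℝ, ‖weilMellin g (1 / 2 + u * I)‖ ^ 2 * reDigammaQuarter u) -
        weilNorm2Sq g * Real.log Real.pi := by
  have e : weilArchTerm (weilConv g (weilReflect g)) =
      ((1 / (2 * Real.pi) * (∫ u : ℝ, ‖weilMellin g (1 / 2 + u * I)‖ ^ 2 * reDigammaQuarter u) -
        weilNorm2Sq g * Real.log Real.pi : ℝ) : ℂ) := by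
    have hI : (∫ t : ℝ, ‖weilMellin g (1 / 2 + t * I)‖ ^ 2 * (Complex.digamma (1 / 4 + t / 2 * I)).re) =
        ∫ u : ℝ, ‖weilMellin g (1 / 2 + u * I)‖ ^ 2 * reDigammaQuarter u := rfl
    unfold weilArchTerm weilNorm2Sq
    rw [weilArchIntegral_weilConv_weilReflect hg, weilConv_weilReflect_apply_zero, hI]
    push_cast
    ring
  rw [e, Complex.ofReal_re]

/-! ### 2. The level comparison (monotone rearrangement at an arbitrary level) -/

/-- **Level comparison.** For a Weil test `g` and every level `T ≥ 0`:
`2π‖g‖₂² ρ(T) − ‖g‖₁² ∫_{−T}^{T} (ρ(T) − ρ(u)) du ≤ ∫ |ĝ(1/2+iu)|² ρ(u) du`.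
Pointwise: with `G = |ĝ|²`, `0 ≤ G ≤ L²`, the function `ρ(T) G − 1_{(−T,T]} L² (ρ(T) − ρ)` is `≤ G ρ`
(for `|u| ≤ T` the difference is `(L² − G)(ρ(T) − ρ(u)) ≥ 0`, for `|u| ≥ T` it is `G (ρ(u) − ρ(T)) ≥ 0`,
both by monotonicity of `ρ` in `|u|`); integrate and use Plancherel `∫ G = 2π‖g‖₂²`. [folklore] -/
theorem level_comparison {g : ℝ → ℂ} (hg : IsWeilTest g) {T : ℝ} (hT : 0 ≤ T) :
    2 * Real.pi * weilNorm2Sq g * reDigammaQuarter T -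
        weilNorm1 g ^ 2 * ∫ u in (-T)..T, (reDigammaQuarter T - reDigammaQuarter u) ≤
      ∫ u : ℝ, ‖weilMellin g (1 / 2 + u * I)‖ ^ 2 * reDigammaQuarter u := by
  set L := weilNorm1 g with hL
  set N := weilNorm2Sq g with hN
  set G : ℝ → ℝ := fun u ↦ ‖weilMellin g (1 / 2 + u * I)‖ ^ 2 with hG
  set ρ : ℝ → ℝ := reDigammaQuarter with hρ
  have hGi : Integrable G := integrable_norm_sq_weilMellin_half_line hg
  have hPl : ∫ u, G u = 2 * Real.pi * N := integral_norm_sq_weilMellin_half_line hg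
  have hGL : ∀ u, G u ≤ L ^ 2 := fun u ↦
    pow_le_pow_left₀ (norm_nonneg _) (norm_weilMellin_half_line_le hg u) 2
  have hG0 : ∀ u, 0 ≤ G u := fun u ↦ by positivity
  have hGρi : Integrable fun u ↦ G u * ρ u := integrable_norm_sq_weilMellin_mul_reDigammaQuarter hg
  have hc : Continuous ρ := continuous_reDigammaQuarter
  have hTT : -T ≤ T := by linarith
  -- the dropped part `k = 1_{(−T,T]} L² (ρ(T) − ρ)` and the comparison function `h = ρ(T) G − k`
  set k : ℝ → ℝ := (Ioc (-T) T).indicator (fun u ↦ L ^ 2 * (ρ T - ρ u)) with hk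
  have hki : Integrable k :=
    ((continuous_const.mul (continuous_const.sub hc)).intervalIntegrable (-T) T).1.integrable_indicator
      measurableSet_Ioc
  have hkval : ∫ u, k u = L ^ 2 * ∫ u in (-T)..T, (ρ T - ρ u) := by
    rw [hk, integral_indicator measurableSet_Ioc, ← intervalIntegral.integral_of_le hTT,
      intervalIntegral.integral_const_mul]
  have hhi : Integrable fun u ↦ ρ T * G u - k u := (hGi.const_mul _).sub hki
  have hhval : ∫ u, (ρ T * G u - k u) = 2 * Real.pi * N * ρ T - L ^ 2 * ∫ u in (-T)..T, (ρ T - ρ u) := by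
    rw [integral_sub (hGi.const_mul _) hki, integral_const_mul, hkval, hPl]
    ring
  -- pointwise comparison
  have hpt : ∀ u, ρ T * G u - k u ≤ G u * ρ u := by
    intro u
    by_cases hu : u ∈ Ioc (-T) T
    · have hku : k u = L ^ 2 * (ρ T - ρ u) := by rw [hk]; exact indicator_of_mem hu _
      have hρu : ρ u ≤ ρ T := reDigammaQuarter_mono (abs_le_abs hu.2 (by linarith [hu.1]))
      have hprod : 0 ≤ (L ^ 2 - G u) * (ρ T - ρ u) :=
        mul_nonneg (sub_nonneg.2 (hGL u)) (sub_nonneg.2 hρu)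
      rw [hku]
      nlinarith
    · have hku : k u = 0 := by rw [hk]; exact indicator_of_notMem hu _
      have hTu : |T| ≤ |u| := by
        rw [abs_of_nonneg hT]
        simp only [mem_Ioc, not_and_or, not_lt, not_le] at hu
        rcases hu with h1 | h1
        · linarith [neg_abs_le u]
        · linarith [le_abs_self u]
      have hρu : ρ T ≤ ρ u := reDigammaQuarter_mono hTu
      have hprod : ρ T * G u ≤ ρ u * G u := mul_le_mul_of_nonneg_right hρu (hG0 u)
      rw [hku, sub_zero, mul_comm (G u)]
      exact hprod
  have hmono := integral_mono hhi hGρi hpt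
  rwa [hhval] at hmono

/-! ### 3. Step comparison on `[0, 2]` -/

/-- One monotone step: for `0 ≤ a ≤ b`, `(b − a) ρ(a) ≤ ∫_a^b ρ`. [folklore] -/
theorem step_le_integral_reDigammaQuarter {a b : ℝ} (ha : 0 ≤ a) (hab : a ≤ b) :
    (b - a) * reDigammaQuarter a ≤ ∫ u in a..b, reDigammaQuarter u := by
  have h := intervalIntegral.integral_mono_on hab (intervalIntegrable_const (μ := volume))
    (continuous_reDigammaQuarter.intervalIntegrable a b)
    (fun u hu ↦ reDigammaQuarter_mono (t := u) (u := a)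
      (by rw [abs_of_nonneg ha, abs_of_nonneg (ha.trans hu.1)]; exact hu.1))
  rwa [intervalIntegral.integral_const, smul_eq_mul] at h

/-- First-term minorant of the vertical series: `ψ(¼) + 16a²/(1 + 4a²) ≤ ρ(a)`, with
`ψ(¼) ≥ −4.22745354`. [folklore] -/
theorem reDigammaQuarter_ge_first (a : ℝ) :
    -4.22745354 + 16 * a ^ 2 / (1 + 4 * a ^ 2) ≤ reDigammaQuarter a := by
  have h := sum_digammaTerm_le 1 a
  rw [Finset.sum_range_one] at h
  have h0 : (-4.22745354 : ℝ) ≤ reDigammaQuarter 0 := by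
    rw [reDigammaQuarter_zero]; exact re_digamma_one_quarter_ge
  have ht : digammaTerm (digammaNode 0) a = 16 * a ^ 2 / (1 + 4 * a ^ 2) := by
    simp only [digammaTerm, digammaNode, Nat.cast_zero, mul_zero, zero_add]
    have h1 : (0 : ℝ) < 1 + 4 * a ^ 2 := by positivity
    field_simp
    ring
  linarith

/-- **Step comparison on `[0, 2]`:** `∫_0^2 ρ ≥ −4.055` (four half-unit monotone steps with the first-term
minorant at `a = 0, 1/2, 1, 3/2`: `ρ ≥ −4.2275, −2.2275, −1.0275, −0.6275`). [folklore] -/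
theorem integral_reDigammaQuarter_zero_two_ge :
    -(4055 / 1000 : ℝ) ≤ ∫ u in (0 : ℝ)..2, reDigammaQuarter u := by
  have hc : Continuous reDigammaQuarter := continuous_reDigammaQuarter
  have s1 := step_le_integral_reDigammaQuarter (a := 0) (b := 1 / 2) le_rfl (by norm_num)
  have s2 := step_le_integral_reDigammaQuarter (a := 1 / 2) (b := 1) (by norm_num) (by norm_num)
  have s3 := step_le_integral_reDigammaQuarter (a := 1) (b := 3 / 2) (by norm_num) (by norm_num)
  have s4 := step_le_integral_reDigammaQuarter (a := 3 / 2) (b := 2) (by norm_num) (by norm_num)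
  have v1 : -4.22745354 + 0 ≤ reDigammaQuarter 0 := by
    have h := reDigammaQuarter_ge_first 0
    have e : (16 : ℝ) * 0 ^ 2 / (1 + 4 * 0 ^ 2) = 0 := by norm_num
    rwa [e] at h
  have v2 : -4.22745354 + 2 ≤ reDigammaQuarter (1 / 2) := by
    have h := reDigammaQuarter_ge_first (1 / 2)
    have e : (16 : ℝ) * (1 / 2) ^ 2 / (1 + 4 * (1 / 2) ^ 2) = 2 := by norm_num
    rwa [e] at h
  have v3 : -4.22745354 + 16 / 5 ≤ reDigammaQuarter 1 := by
    have h := reDigammaQuarter_ge_first 1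
    have e : (16 : ℝ) * 1 ^ 2 / (1 + 4 * 1 ^ 2) = 16 / 5 := by norm_num
    rwa [e] at h
  have v4 : -4.22745354 + 18 / 5 ≤ reDigammaQuarter (3 / 2) := by
    have h := reDigammaQuarter_ge_first (3 / 2)
    have e : (16 : ℝ) * (3 / 2) ^ 2 / (1 + 4 * (3 / 2) ^ 2) = 18 / 5 := by norm_num
    rwa [e] at h
  have e : ∫ u in (0 : ℝ)..2, reDigammaQuarter u =
      (∫ u in (0 : ℝ)..(1 / 2), reDigammaQuarter u) + (∫ u in (1 / 2 : ℝ)..1, reDigammaQuarter u) +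
        (∫ u in (1 : ℝ)..(3 / 2), reDigammaQuarter u) + (∫ u in (3 / 2 : ℝ)..2, reDigammaQuarter u) := by
    rw [intervalIntegral.integral_add_adjacent_intervals (hc.intervalIntegrable _ _) (hc.intervalIntegrable _ _),
      intervalIntegral.integral_add_adjacent_intervals (hc.intervalIntegrable _ _) (hc.intervalIntegrable _ _),
      intervalIntegral.integral_add_adjacent_intervals (hc.intervalIntegrable _ _) (hc.intervalIntegrable _ _)]
  rw [e]
  linarith

/-! ### 4. Log comparison on `[2, T]` -/

/-- **Pointwise log minorant.** For `u > 0`: `log(u/2) − (1/2 + π/3)/u² − 4/(3u³) ≤ ρ(u)`, from the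
second-order Stirling bound `|Re ψ(w) − log‖w‖ + Re(1/(2w))| ≤ 1/(6|Im w|³) + π/(12 (Im w)²)` at
`w = 1/4 + iu/2` (`‖w‖ ≥ u/2`, `Re(1/(2w)) = 2/(1 + 4u²) ≤ 1/(2u²)`). [folklore] -/
theorem reDigammaQuarter_ge_log {u : ℝ} (hu : 0 < u) :
    Real.log (u / 2) - (1 / 2 + Real.pi / 3) / u ^ 2 - 4 / (3 * u ^ 3) ≤ reDigammaQuarter u := by
  set w : ℂ := 1 / 4 + (u : ℂ) / 2 * I with hw
  have hre : w.re = 1 / 4 := by simp [hw]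
  have him : w.im = u / 2 := by simp [hw]
  have hwre : 0 < w.re := by rw [hre]; norm_num
  have hwim : w.im ≠ 0 := by rw [him]; positivity
  have h := Literature.NumberTheory.LFunctions.Complex.abs_re_digamma_sub_log_norm_add_re_le hwre hwim
  have hρ : (Complex.digamma w).re = reDigammaQuarter u := rfl
  rw [hρ, him, abs_of_pos (by positivity : 0 < u / 2)] at h
  have h' := (abs_le.1 h).1
  -- `log(u/2) ≤ log ‖w‖`
  have hnorm : u / 2 ≤ ‖w‖ := by
    have := Complex.abs_im_le_norm w
    rwa [him, abs_of_pos (by positivity : 0 < u / 2)] at this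
  have hlog : Real.log (u / 2) ≤ Real.log ‖w‖ := Real.log_le_log (by positivity) hnorm
  -- `Re(1/(2w)) = 2/(1 + 4u²) ≤ 1/(2u²)`
  have hinv : (1 / (2 * w)).re = 2 / (1 + 4 * u ^ 2) := by
    have e2 : 2 * w = ((1 / 2 : ℝ) : ℂ) + (u : ℂ) * I := by
      rw [hw]; push_cast; ring
    rw [e2, one_div, Complex.inv_re, Complex.normSq_apply]
    simp only [Complex.add_re, Complex.ofReal_re, Complex.mul_re, Complex.I_re, Complex.ofReal_im,
      Complex.I_im, Complex.add_im, Complex.mul_im]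
    have h1 : (0 : ℝ) < 1 + 4 * u ^ 2 := by positivity
    field_simp
    ring
  have hinv_le : 2 / (1 + 4 * u ^ 2) ≤ 1 / (2 * u ^ 2) := by
    rw [div_le_div_iff₀ (by positivity) (by positivity)]
    nlinarith [sq_nonneg u]
  -- the error terms
  have e1 : 1 / (6 * (u / 2) ^ 3) = 4 / (3 * u ^ 3) := by
    field_simp
    ring
  have e2 : Real.pi / (12 * (u / 2) ^ 2) = Real.pi / 3 / u ^ 2 := by
    field_simp
    ring
  rw [e1, e2, hinv] at h'
  have e3 : (1 / 2 + Real.pi / 3) / u ^ 2 = 1 / (2 * u ^ 2) + Real.pi / 3 / u ^ 2 := by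
    field_simp
  rw [e3]
  linarith

/-- **Log comparison on `[2, T]`:** for `T ≥ 2`,
`T log(T/2) − T + 2 − (5/12 + π/6) ≤ ∫_2^T ρ`, by the fundamental theorem of calculus in inequality form
applied to `F(u) = u log(u/2) − u + (1/2 + π/3)/u + 2/(3u²)`, whose derivative is the pointwise log
minorant, and `F(T) ≥ T log(T/2) − T`, `F(2) = −2 + 5/12 + π/6`. [folklore] -/
theorem integral_reDigammaQuarter_two_ge {T : ℝ} (hT : 2 ≤ T) :
    T * Real.log (T / 2) - T + 2 - (5 / 12 + Real.pi / 6) ≤ ∫ u in (2 : ℝ)..T, reDigammaQuarter u := by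
  set c : ℝ := 1 / 2 + Real.pi / 3 with hc
  set F : ℝ → ℝ := fun u ↦ u * Real.log (u / 2) - u + c * u⁻¹ + 2 / 3 * (u ^ 2)⁻¹ with hF
  set f : ℝ → ℝ := fun u ↦ Real.log (u / 2) - c * (u ^ 2)⁻¹ - 4 / 3 * (u ^ 3)⁻¹ with hf
  -- the derivative of `F` on `(0, ∞)` is `f`
  have hderiv : ∀ u : ℝ, 0 < u → HasDerivAt F (f u) u := by
    intro u hu
    have hu0 : u ≠ 0 := hu.ne'
    have h1 : HasDerivAt (fun x : ℝ ↦ Real.log (x / 2)) ((1 / 2) / (u / 2)) u :=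
      ((hasDerivAt_id' u).div_const 2).log (by positivity)
    have h2 : HasDerivAt (fun x : ℝ ↦ x * Real.log (x / 2)) (1 * Real.log (u / 2) + u * ((1 / 2) / (u / 2))) u :=
      (hasDerivAt_id' u).mul h1
    have h3 : HasDerivAt (fun x : ℝ ↦ c * x⁻¹) (c * (-(u ^ 2)⁻¹)) u := (hasDerivAt_inv hu0).const_mul c
    have h4 : HasDerivAt (fun x : ℝ ↦ (2 / 3 : ℝ) * (x ^ 2)⁻¹)
        (2 / 3 * (-(↑(2 : ℕ) * u ^ (2 - 1)) / (u ^ 2) ^ 2)) u :=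
      ((hasDerivAt_pow 2 u).inv (pow_ne_zero 2 hu0)).const_mul (2 / 3)
    have h5 := ((h2.sub (hasDerivAt_id' u)).add h3).add h4
    have e : (1 * Real.log (u / 2) + u * ((1 / 2) / (u / 2)) - 1 + c * (-(u ^ 2)⁻¹) +
        2 / 3 * (-(↑(2 : ℕ) * u ^ (2 - 1)) / (u ^ 2) ^ 2)) = f u := by
      simp only [hf]
      field_simp
      ring
    rw [e] at h5
    exact h5
  have hcont : ContinuousOn F (Icc 2 T) := fun x hx ↦
    (hderiv x (by linarith [hx.1])).continuousAt.continuousWithinAt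
  have hderiv' : ∀ x ∈ Ioo 2 T, HasDerivWithinAt F (f x) (Ioi x) x := fun x hx ↦
    (hderiv x (by linarith [hx.1])).hasDerivWithinAt
  have hint : IntegrableOn reDigammaQuarter (Icc 2 T) := continuous_reDigammaQuarter.integrableOn_Icc
  have hle : ∀ x ∈ Ioo 2 T, f x ≤ reDigammaQuarter x := fun x hx ↦ by
    have h := reDigammaQuarter_ge_log (u := x) (by linarith [hx.1])
    have e : f x = Real.log (x / 2) - (1 / 2 + Real.pi / 3) / x ^ 2 - 4 / (3 * x ^ 3) := by
      simp only [hf, hc]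
      ring
    rwa [← e] at h
  have key := intervalIntegral.sub_le_integral_of_hasDeriv_right_of_le hT hcont hderiv' hint hle
  -- `F T ≥ T log(T/2) − T` and `F 2 = −2 + 5/12 + π/6`
  have hT0 : 0 < T := by linarith
  have hFT : T * Real.log (T / 2) - T ≤ F T := by
    have h1 : 0 ≤ c * T⁻¹ := by positivity
    have h2 : 0 ≤ 2 / 3 * (T ^ 2)⁻¹ := by positivity
    simp only [hF]
    linarith
  have hF2 : F 2 = -2 + (5 / 12 + Real.pi / 6) := by
    simp only [hF, hc]
    rw [show (2 : ℝ) / 2 = 1 by norm_num, Real.log_one]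
    ring
  linarith

/-! ### 5. The symmetric integral and the stub -/

/-- For `T ≥ 2`: `2T(log(T/2) − 1) − 63/10 ≤ ∫_{−T}^{T} ρ` (evenness, the step comparison on `[0,2]` and the
log comparison on `[2,T]`, with `π ≤ 4`; the true deficit is `π/2`, and the stub only needs `42/5`). [folklore] -/
theorem integral_reDigammaQuarter_symm_ge {T : ℝ} (hT : 2 ≤ T) :
    2 * T * (Real.log (T / 2) - 1) - 63 / 10 ≤ ∫ u in (-T)..T, reDigammaQuarter u := by
  have hc : Continuous reDigammaQuarter := continuous_reDigammaQuarter
  have h1 : ∫ u in (-T)..0, reDigammaQuarter u = ∫ u in (0 : ℝ)..T, reDigammaQuarter u := by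
    have h := intervalIntegral.integral_comp_neg reDigammaQuarter (a := 0) (b := T)
    simp only [neg_zero, reDigammaQuarter_even] at h
    exact h.symm
  have h2 : ∫ u in (0 : ℝ)..T, reDigammaQuarter u =
      (∫ u in (0 : ℝ)..2, reDigammaQuarter u) + ∫ u in (2 : ℝ)..T, reDigammaQuarter u :=
    (intervalIntegral.integral_add_adjacent_intervals (hc.intervalIntegrable _ _)
      (hc.intervalIntegrable _ _)).symm
  rw [← intervalIntegral.integral_add_adjacent_intervals (hc.intervalIntegrable (-T) 0)
    (hc.intervalIntegrable 0 T), h1, h2]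
  have hA := integral_reDigammaQuarter_zero_two_ge
  have hB := integral_reDigammaQuarter_two_ge hT
  have hπ := Real.pi_le_four
  linarith

/-- **Stub S3 — bathtub bound for the archimedean diagonal of a Weil test** (explicit monotone
comparison). For a Weil test `g` with `0 < ‖g‖₁` and `2‖g‖₁² ≤ π‖g‖₂²`:
`‖g‖₂² (log(‖g‖₂²/(2‖g‖₁²)) − 1) − (21/(5π)) ‖g‖₁² ≤ Re W_∞(g ⋆ g̃)`.
Proof: `re_weilArchTerm_autocorr`, the level comparison at `T = π‖g‖₂²/‖g‖₁² ≥ 2` (where it reads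
`‖g‖₁² ∫_{−T}^{T} ρ ≤ ∫ G ρ`), `integral_reDigammaQuarter_symm_ge`, and `‖g‖₁² T = π‖g‖₂²`. -/
theorem stub_archBathtub : ∀ g : ℝ → ℂ, IsWeilTest g → 0 < weilNorm1 g →
    2 * weilNorm1 g ^ 2 ≤ Real.pi * weilNorm2Sq g →
    weilNorm2Sq g * (Real.log (weilNorm2Sq g / (2 * weilNorm1 g ^ 2)) - 1) -
        21 / (5 * Real.pi) * weilNorm1 g ^ 2 ≤
      (weilArchTerm (weilConv g (weilReflect g))).re := by
  intro g hg hL hcond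
  set N := weilNorm2Sq g with hN
  set L := weilNorm1 g with hL'
  have hπ : 0 < Real.pi := Real.pi_pos
  have hL2 : 0 < L ^ 2 := by positivity
  have hN0 : 0 < N := pos_of_mul_pos_right (by linarith : 0 < Real.pi * N) hπ.le
  set T : ℝ := Real.pi * N / L ^ 2 with hT
  have hLT : L ^ 2 * T = Real.pi * N := by rw [hT]; field_simp
  have hT2 : 2 ≤ T := by rw [hT, le_div_iff₀ hL2]; linarith
  have hT0 : 0 ≤ T := by linarith
  set A : ℝ := ∫ u : ℝ, ‖weilMellin g (1 / 2 + u * I)‖ ^ 2 * reDigammaQuarter u with hA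
  -- Step 1: the archimedean term
  have harch := re_weilArchTerm_autocorr hg
  rw [← hA] at harch
  -- Step 2: the level comparison at `T = πN/L²` is the bathtub value `L² ∫_{-T}^{T} ρ ≤ A`
  have hlev := level_comparison hg hT0
  rw [← hA, ← hN, ← hL'] at hlev
  have hsplit : ∫ u in (-T)..T, (reDigammaQuarter T - reDigammaQuarter u) =
      2 * T * reDigammaQuarter T - ∫ u in (-T)..T, reDigammaQuarter u := by
    rw [intervalIntegral.integral_sub intervalIntegrable_const
      (continuous_reDigammaQuarter.intervalIntegrable _ _), intervalIntegral.integral_const, smul_eq_mul]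
    ring
  have hbath : L ^ 2 * ∫ u in (-T)..T, reDigammaQuarter u ≤ A := by
    rw [hsplit] at hlev
    have e : 2 * Real.pi * N * reDigammaQuarter T -
        L ^ 2 * (2 * T * reDigammaQuarter T - ∫ u in (-T)..T, reDigammaQuarter u) =
        L ^ 2 * ∫ u in (-T)..T, reDigammaQuarter u := by
      have : L ^ 2 * (2 * T * reDigammaQuarter T) = 2 * Real.pi * N * reDigammaQuarter T := by
        linear_combination (2 * reDigammaQuarter T) * hLT
      linarith
    linarith
  -- Step 3: the symmetric digamma integral (`63/10 ≤ 42/5`)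
  have hstir : 2 * T * (Real.log (T / 2) - 1) - 42 / 5 ≤ ∫ u in (-T)..T, reDigammaQuarter u := by
    linarith [integral_reDigammaQuarter_symm_ge hT2]
  -- Step 4: assemble (`L² T = π N`)
  have hmono : 1 / (2 * Real.pi) * (L ^ 2 * (2 * T * (Real.log (T / 2) - 1) - 42 / 5)) ≤
      1 / (2 * Real.pi) * A := by
    refine mul_le_mul_of_nonneg_left ?_ (by positivity)
    exact (mul_le_mul_of_nonneg_left hstir hL2.le).trans hbath
  have hq : 0 < N / (2 * L ^ 2) := by positivity
  have hlog : Real.log (T / 2) = Real.log Real.pi + Real.log (N / (2 * L ^ 2)) := by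
    rw [← Real.log_mul hπ.ne' hq.ne']
    congr 1
    rw [hT]
    field_simp
  have key : 1 / (2 * Real.pi) * (L ^ 2 * (2 * T * (Real.log (T / 2) - 1) - 42 / 5)) =
      N * (Real.log (N / (2 * L ^ 2)) - 1) + N * Real.log Real.pi - 21 / (5 * Real.pi) * L ^ 2 := by
    have e : L ^ 2 * (2 * T * (Real.log (T / 2) - 1) - 42 / 5) =
        2 * (Real.pi * N) * (Real.log (T / 2) - 1) - 42 / 5 * L ^ 2 := by
      rw [← hLT]; ring
    rw [e, hlog]
    field_simp
    ring
  rw [harch]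
  linarith [key, hmono]

end Summit.RiemannHypothesis.RiemannHypothesis.Theorems.WeilCombBohrFejer.ArchMonotone

end
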